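import Literature.RepresentationTheory.BorelWallach2000.U11ContragredientLoewy
import Literature.RepresentationTheory.BorelWallach2000.U11PrincipalSeriesUniserial
import Literature.RepresentationTheory.BorelWallach2000.U11TranslationPrincipalSeries
import Literature.Algebra.Module.UniserialRadicalSeries
import HarnessLib

/-!
# The contragredient of a uniserial `(𝔤, K)`-module of `U(1,1)` is uniserial; the contragredient `P(s, λ)~` of the principal series:
# uniserial of length `3`, `soc(P~) = W(a₁)^⊥`, `rad(P~) = soc²(P~) = W(a₂)^⊥` (Borel–Wallach 0 §2.5; Bump Thm. 2.5.3; Anderson–Fuller 32.1)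

Family `hodge`, lane `lit-hodgefound` (foundations library; seat `lit-hodgefound-p39`, generation 34, row g34-#8); topic
`RepresentationTheory/BorelWallach2000`, namespaces `…BorelWallach2000.U11DualFunctor` and `…U11PS` (continued).  Sequel of g34-#2
(`U11ContragredientLoewy`: `(socⁿ M)^⊥ = radⁿ(M~)`, `(radⁿ M)^⊥ = socⁿ(M~)`, `ℓℓ(M~) = ℓℓ(M)`), g34-#7 (`UniserialRadicalSeries`: uniseriality passes
along lattice anti-isomorphisms; `radᵏ M = soc^{ht−k} M` for uniserial `M`), g33-#15/#17 (`U11PrincipalSeriesLoewy`/`Uniserial`: `soc P = W(a₂)`,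
`rad P = W(a₁)`, `soc² P = W(a₁)`, `rad² P = W(a₂)`, `P` uniserial, `ht = ℓ = ℓℓ = 3`) and g32-#9/#10 (`U^⊥`, `annOrderIso`, `ℓ(M~) = ℓ(M)`).
What is formalised: (i) for an admissible `(𝔤, K)`-module `M` of `U(1,1)` over `R = GKRing G11`, **`M~` is uniserial iff `M` is** (the submodule
lattice of `M~` is the dual lattice), and for uniserial `M` of finite length the socle series of `M~` is `(soc^{ht−k} M)^⊥` — the annihilators of
the socle series of `M` read backwards; (ii) for the principal series `P = P(s, λ)` with two zeros `a₁ < a₂` of `lc` (Bump's reducible case):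
**`P~` is uniserial**, `ℓ(P~) = ht(P~) = ℓℓ(P~) = 3`, **`soc(P~) = rad²(P~) = W(a₁)^⊥`**, **`rad(P~) = soc²(P~) = W(a₂)^⊥`**, and `P~` has exactly the
four submodules `0 < W(a₁)^⊥ < W(a₂)^⊥ < P~`.
Theorems only, 0 `sorry`, no definition, no named fact (net debt 0, D-0026), no new instance, no notation.

## The sources

Borel–Wallach [BorelWallach2000, 0 §2.5, I §2.2] (contragredient `(𝔤, K)`-module); Bump [Bump1997, Thm. 2.5.3 (ii)–(iii), Thm. 2.5.4 (ii)] (the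
submodules `ℌ₊ ⊋ …` of the reducible principal series of `GL(2, ℝ)`, here at `U(1,1)`: `0 < W(a₂) < W(a₁) < P`); Anderson–Fuller [AndersonFuller1992,
§32, Lemma 32.1] (uniserial modules; upper/lower Loewy series); Krause [Krause2021, Conventions; Lemma 13.1.26].  Everything here is these
statements combined with the lattice anti-isomorphism `U ↦ U^⊥` — proved, not quoted.

## What is formalised (`R = GKRing G11`, `M~ = GKDual.dualModule`)

* §1 (`U11DualFunctor`, admissible `M`) **`isUniserial_dualModule_iff`**, `isUniserial_dualModule`; for uniserial `M` of finite length
  **`socleSeries_dualModule_of_isUniserial : socᵏ(M~) = (soc^{ht−k} M)^⊥`**, **`radicalSeries_dualModule_of_isUniserial : radᵏ(M~) = (rad^{ℓℓ−k} M)^⊥`**.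
* §2 (`U11PS`, the principal series `P = P(s, λ)`; `hP = U11TranslPS.isGKModule_psMod s lam`) `isAdmissibleGK_psMod`, **`isUniserial_dualModule_psMod`**;
  with two zeros `a₁ < a₂`: `length_dualModule_psMod = 3`, `loewyLength_dualModule_psMod = 3`, `socleLength_dualModule_psMod = 3`,
  **`socle_dualModule_psMod : soc(P~) = W(a₁)^⊥`**, **`jacobson_dualModule_psMod : rad(P~) = W(a₂)^⊥`**, `socleSeries_dualModule_psMod_two : soc²(P~) = W(a₂)^⊥`,
  `radicalSeries_dualModule_psMod_two : rad²(P~) = W(a₁)^⊥`, `socleSeries_dualModule_psMod_three`, `radicalSeries_dualModule_psMod_three`,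
  `ann_upperR_lt_ann_upperR : W(a₁)^⊥ < W(a₂)^⊥`, **`submodule_dualModule_psMod_cases`** (the four submodules of `P~`).

## Mathlib / Literature search

g32-#9/#10 `GKDual.ann`, `ann_bot`, `ann_top`, `ann_strictAnti`, `ann_surjective`, `annOrderIso`, `length_dualModule`; g34-#2 `ann_socle(Series)`,
`ann_jacobson`, `ann_radicalSeries`, `loewyLength_dualModule_eq`, `socleLength_dualModule_eq`; g34-#7 `isUniserial_iff_of_antiIso`,
`IsUniserial.radicalSeries_eq_socleSeries`, `IsUniserial.socleSeries_eq_radicalSeries`; g33-#15/#17 `socle_psMod`, `jacobson_psMod`, `radicalSeries_psMod_two/_three`,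
`socleSeries_psMod_two/_three`, `isUniserial_psMod`, `socleLength_psMod`, `loewyLength_psMod`, `submodule_cases`, `upperR_le_upperR_iff`, `length_eq_three`;
`U11PS.isFiniteLength`, `U11TranslPS.isGKModule_psMod`, `U11HC.isAdmissibleGK_of_isFiniteLength`.  `rg -n 'isUniserial_dualModule|dualModule_psMod'` → nothing in the tree.

## References

* A. Borel, N. Wallach, *Continuous Cohomology, Discrete Subgroups, and Representations of Reductive Groups*, 2nd ed., AMS (2000), 0 §2.5, I §2.2.
  [BorelWallach2000]
* D. Bump, *Automorphic Forms and Representations*, CUP (1997), Thm. 2.5.3, Thm. 2.5.4. [Bump1997]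
* F. W. Anderson, K. R. Fuller, *Rings and Categories of Modules*, 2nd ed., GTM 13 (1992), §32, Lemma 32.1. [AndersonFuller1992]
* H. Krause, *Homological Theory of Representations*, CUP (2021), Conventions (p. xxiv); Lemma 13.1.26. [Krause2021]
-/

noncomputable section

open scoped Matrix ComplexConjugate
open Module

namespace Literature.RepresentationTheory.BorelWallach2000

open Literature.Algebra.Lie Literature.Algebra.Lie.ChevalleyEilenberg
open Literature.Algebra.Module
open Literature.NumberTheory.Automorphic
open Literature.RepresentationTheory.KonnoKonno2007 Literature.RepresentationTheory.KonnoKonno2007.RealDualPair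
open Literature.RepresentationTheory.KonnoKonno2007.RealDualPair.UForm
open Literature.LinearAlgebra
open U11HolDS

-- Mathlib idiom (as in `GKModules`, `GKCohomology`): commutator bracket on `Module.End` / matrices
attribute [local instance 100] LieRing.ofAssociativeRing

namespace U11DualFunctor

variable {M : Type*} [AddCommGroup M] [Module ℂ M] [Module (GKRing G11) M] [IsScalarTower ℂ (GKRing G11) M]
  (hM : IsGKModule G11 (GKRing.actK G11 M) (GKRing.actLie G11 M))

/-! ## §1 The contragredient of a uniserial module is uniserial -/

/-- **`M~` is uniserial iff `M` is**, for an admissible `(𝔤, K)`-module `M` of `U(1,1)`: the submodule lattice of `M~` is anti-isomorphic to that of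
`M` (`U ↦ U^⊥`, g32-#10) and uniseriality is a self-dual lattice property (g34-#7). [cite: BorelWallach2000, 0 §2.5, I §2.2]
[cite: AndersonFuller1992, §32, Lemma 32.1 (c)⇔(d)] -/
theorem isUniserial_dualModule_iff (hadm : IsAdmissibleGK (GKRing.actK G11 M)) :
    SocleRadical.IsUniserial (GKRing G11) (GKDual.dualModule G11 hM) ↔ SocleRadical.IsUniserial (GKRing G11) M :=
  (SocleRadical.isUniserial_iff_of_antiIso (annOrderIso hM hadm)).symm

/-- The contragredient of a uniserial admissible module is uniserial. [cite: BorelWallach2000, 0 §2.5, I §2.2] [cite: AndersonFuller1992, §32, Lemma 32.1] -/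
theorem isUniserial_dualModule (hadm : IsAdmissibleGK (GKRing.actK G11 M)) (h : SocleRadical.IsUniserial (GKRing G11) M) :
    SocleRadical.IsUniserial (GKRing G11) (GKDual.dualModule G11 hM) :=
  h.of_antiIso (annOrderIso hM hadm)

/-- **`socᵏ(M~) = (soc^{ht(M)−k} M)^⊥`** for a uniserial `M` of finite length (`k ≤ ht(M)`): `socᵏ(M~) = (radᵏ M)^⊥` (g34-#2) and the radical series of
a uniserial module is its socle series reversed (g34-#7). [cite: BorelWallach2000, 0 §2.5, I §2.2] [cite: AndersonFuller1992, Lemma 32.1]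
[cite: Krause2021, Lemma 13.1.26] -/
theorem socleSeries_dualModule_of_isUniserial (hfl : IsFiniteLength (GKRing G11) M) (h : SocleRadical.IsUniserial (GKRing G11) M) {k : ℕ}
    (hk : k ≤ SocleRadical.socleLength (GKRing G11) M) :
    SocleRadical.socleSeries (GKRing G11) (GKDual.dualModule G11 hM) k =
      GKDual.ann G11 hM (SocleRadical.socleSeries (GKRing G11) M (SocleRadical.socleLength (GKRing G11) M - k)) := by
  have hadm := U11HC.isAdmissibleGK_of_isFiniteLength hM hfl
  obtain ⟨_, _⟩ := isFiniteLength_iff_isNoetherian_isArtinian.mp hfl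
  rw [← ann_radicalSeries hM hadm, h.radicalSeries_eq_socleSeries hk]

/-- **`radᵏ(M~) = (rad^{ℓℓ(M)−k} M)^⊥`** for a uniserial `M` of finite length (`k ≤ ℓℓ(M)`). [cite: BorelWallach2000, 0 §2.5, I §2.2]
[cite: AndersonFuller1992, Lemma 32.1] [cite: Krause2021, Lemma 13.1.26] -/
theorem radicalSeries_dualModule_of_isUniserial (hfl : IsFiniteLength (GKRing G11) M) (h : SocleRadical.IsUniserial (GKRing G11) M) {k : ℕ}
    (hk : k ≤ SocleRadical.loewyLength (GKRing G11) M) :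
    SocleRadical.radicalSeries (GKRing G11) (GKDual.dualModule G11 hM) k =
      GKDual.ann G11 hM (SocleRadical.radicalSeries (GKRing G11) M (SocleRadical.loewyLength (GKRing G11) M - k)) := by
  have hadm := U11HC.isAdmissibleGK_of_isFiniteLength hM hfl
  obtain ⟨_, _⟩ := isFiniteLength_iff_isNoetherian_isArtinian.mp hfl
  rw [SocleRadical.loewyLength_eq_socleLength] at hk ⊢
  rw [← ann_socleSeries hM hadm, h.socleSeries_eq_radicalSeries hk]

end U11DualFunctor

/-! ## §2 The contragredient `P(s, λ)~` of the principal series -/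

namespace U11PS

variable {s : ℤ} {lam : ℂ}

/-- `P(s, λ)` over the operator ring is admissible (finite length ⟹ admissible, `U11HC`; or Bump Thm. 2.5.3: each `K`-type once).
[cite: Bump1997, Thm. 2.5.3] [cite: BorelWallach2000, 0 §2.4] -/
theorem isAdmissibleGK_psMod : IsAdmissibleGK (GKRing.actK G11 (psMod s lam)) :=
  U11HC.isAdmissibleGK_of_isFiniteLength (U11TranslPS.isGKModule_psMod s lam) isFiniteLength

/-- **The contragredient `P(s, λ)~` of the principal series of `U(1,1)` is uniserial** (for all `s`, `λ`). [cite: BorelWallach2000, 0 §2.5, I §2.2]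
[cite: Bump1997, Thm. 2.5.3] [cite: AndersonFuller1992, §32, Lemma 32.1] -/
theorem isUniserial_dualModule_psMod :
    SocleRadical.IsUniserial (GKRing G11) (GKDual.dualModule G11 (U11TranslPS.isGKModule_psMod s lam)) :=
  U11DualFunctor.isUniserial_dualModule _ isAdmissibleGK_psMod isUniserial_psMod

/-- `ℓ(P~) = 3` for two distinct zeros `a₁ < a₂` (`ℓ(M~) = ℓ(M)`, g32-#10). [cite: Bump1997, Thm. 2.5.3 (ii)–(iii), Thm. 2.5.4 (ii)]
[cite: BorelWallach2000, 0 §2.5, I §2.2] -/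
theorem length_dualModule_psMod {a₁ a₂ : ℤ} (h₁ : lc s lam a₁ = 0) (h₂ : lc s lam a₂ = 0) (h₁₂ : a₁ + a₂ = s + 1) (hlt : a₁ < a₂) :
    Module.length (GKRing G11) (GKDual.dualModule G11 (U11TranslPS.isGKModule_psMod s lam)) = 3 := by
  rw [U11DualFunctor.length_dualModule, length_eq_three h₁ h₂ h₁₂ hlt]

/-- `ℓℓ(P~) = 3` for two distinct zeros. [cite: Bump1997, Thm. 2.5.4 (ii)] [cite: Krause2021, Conventions «Radical»] [cite: BorelWallach2000, 0 §2.5] -/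
theorem loewyLength_dualModule_psMod {a₁ a₂ : ℤ} (h₁ : lc s lam a₁ = 0) (h₂ : lc s lam a₂ = 0) (h₁₂ : a₁ + a₂ = s + 1) (hlt : a₁ < a₂) :
    SocleRadical.loewyLength (GKRing G11) (GKDual.dualModule G11 (U11TranslPS.isGKModule_psMod s lam)) = 3 := by
  rw [U11DualFunctor.loewyLength_dualModule_eq _ isFiniteLength, loewyLength_psMod h₁ h₂ h₁₂ hlt]

/-- `ht(P~) = 3` for two distinct zeros. [cite: Bump1997, Thm. 2.5.4 (ii)] [cite: Krause2021, Conventions «Socle»] [cite: BorelWallach2000, 0 §2.5] -/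
theorem socleLength_dualModule_psMod {a₁ a₂ : ℤ} (h₁ : lc s lam a₁ = 0) (h₂ : lc s lam a₂ = 0) (h₁₂ : a₁ + a₂ = s + 1) (hlt : a₁ < a₂) :
    SocleRadical.socleLength (GKRing G11) (GKDual.dualModule G11 (U11TranslPS.isGKModule_psMod s lam)) = 3 := by
  rw [U11DualFunctor.socleLength_dualModule_eq _ isFiniteLength, socleLength_psMod h₁ h₂ h₁₂ hlt]

/-- **`soc(P~) = W(a₁)^⊥ = (rad P)^⊥`** for zeros `a₁ ≤ a₂`. [cite: Bump1997, Thm. 2.5.3 (ii)–(iii)] [cite: BorelWallach2000, 0 §2.5, I §2.2]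
[cite: Krause2021, Conventions «Socle», «Radical»] -/
theorem socle_dualModule_psMod {a₁ a₂ : ℤ} (h₁ : lc s lam a₁ = 0) (h₂ : lc s lam a₂ = 0) (h₁₂ : a₁ + a₂ = s + 1) (hle : a₁ ≤ a₂) :
    SocleRadical.socle (GKRing G11) (GKDual.dualModule G11 (U11TranslPS.isGKModule_psMod s lam)) =
      GKDual.ann G11 (U11TranslPS.isGKModule_psMod s lam) (upperR h₁) := by
  rw [← U11DualFunctor.ann_jacobson _ isAdmissibleGK_psMod, jacobson_psMod h₁ h₂ h₁₂ hle]

/-- **`rad(P~) = W(a₂)^⊥ = (soc P)^⊥`** for zeros `a₁ ≤ a₂`. [cite: Bump1997, Thm. 2.5.3 (ii)–(iii)] [cite: BorelWallach2000, 0 §2.5, I §2.2]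
[cite: Krause2021, Conventions «Socle», «Radical»] -/
theorem jacobson_dualModule_psMod {a₁ a₂ : ℤ} (h₁ : lc s lam a₁ = 0) (h₂ : lc s lam a₂ = 0) (h₁₂ : a₁ + a₂ = s + 1) (hle : a₁ ≤ a₂) :
    Module.jacobson (GKRing G11) (GKDual.dualModule G11 (U11TranslPS.isGKModule_psMod s lam)) =
      GKDual.ann G11 (U11TranslPS.isGKModule_psMod s lam) (upperR h₂) := by
  rw [← U11DualFunctor.ann_socle _ isAdmissibleGK_psMod, socle_psMod h₁ h₂ h₁₂ hle]

/-- `soc²(P~) = W(a₂)^⊥ = (rad² P)^⊥` for `a₁ < a₂`. [cite: Bump1997, Thm. 2.5.3 (ii)–(iii)] [cite: BorelWallach2000, 0 §2.5] [cite: Krause2021, Conventions «Socle»] -/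
theorem socleSeries_dualModule_psMod_two {a₁ a₂ : ℤ} (h₁ : lc s lam a₁ = 0) (h₂ : lc s lam a₂ = 0) (h₁₂ : a₁ + a₂ = s + 1) (hlt : a₁ < a₂) :
    SocleRadical.socleSeries (GKRing G11) (GKDual.dualModule G11 (U11TranslPS.isGKModule_psMod s lam)) 2 =
      GKDual.ann G11 (U11TranslPS.isGKModule_psMod s lam) (upperR h₂) := by
  rw [← U11DualFunctor.ann_radicalSeries _ isAdmissibleGK_psMod, radicalSeries_psMod_two h₁ h₂ h₁₂ hlt]

/-- `rad²(P~) = W(a₁)^⊥ = (soc² P)^⊥` for `a₁ < a₂`. [cite: Bump1997, Thm. 2.5.3 (ii)–(iii)] [cite: BorelWallach2000, 0 §2.5] [cite: Krause2021, Conventions «Radical»] -/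
theorem radicalSeries_dualModule_psMod_two {a₁ a₂ : ℤ} (h₁ : lc s lam a₁ = 0) (h₂ : lc s lam a₂ = 0) (h₁₂ : a₁ + a₂ = s + 1) (hlt : a₁ < a₂) :
    SocleRadical.radicalSeries (GKRing G11) (GKDual.dualModule G11 (U11TranslPS.isGKModule_psMod s lam)) 2 =
      GKDual.ann G11 (U11TranslPS.isGKModule_psMod s lam) (upperR h₁) := by
  rw [← U11DualFunctor.ann_socleSeries _ isAdmissibleGK_psMod, socleSeries_psMod_two h₁ h₂ h₁₂ hlt]

/-- `soc³(P~) = P~` for `a₁ < a₂` (`= (rad³ P)^⊥ = 0^⊥`). [cite: Bump1997, Thm. 2.5.4 (ii)] [cite: BorelWallach2000, 0 §2.5] [cite: Krause2021, Conventions «Socle»] -/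
theorem socleSeries_dualModule_psMod_three {a₁ a₂ : ℤ} (h₁ : lc s lam a₁ = 0) (h₂ : lc s lam a₂ = 0) (h₁₂ : a₁ + a₂ = s + 1) (hlt : a₁ < a₂) :
    SocleRadical.socleSeries (GKRing G11) (GKDual.dualModule G11 (U11TranslPS.isGKModule_psMod s lam)) 3 = ⊤ := by
  rw [← U11DualFunctor.ann_radicalSeries _ isAdmissibleGK_psMod, radicalSeries_psMod_three h₁ h₂ h₁₂ hlt, GKDual.ann_bot]

/-- `rad³(P~) = 0` for `a₁ < a₂` (`= (soc³ P)^⊥ = P^⊥`). [cite: Bump1997, Thm. 2.5.4 (ii)] [cite: BorelWallach2000, 0 §2.5] [cite: Krause2021, Conventions «Radical»] -/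
theorem radicalSeries_dualModule_psMod_three {a₁ a₂ : ℤ} (h₁ : lc s lam a₁ = 0) (h₂ : lc s lam a₂ = 0) (h₁₂ : a₁ + a₂ = s + 1) (hlt : a₁ < a₂) :
    SocleRadical.radicalSeries (GKRing G11) (GKDual.dualModule G11 (U11TranslPS.isGKModule_psMod s lam)) 3 = ⊥ := by
  rw [← U11DualFunctor.ann_socleSeries _ isAdmissibleGK_psMod, socleSeries_psMod_three h₁ h₂ h₁₂ hlt, GKDual.ann_top]

/-- `W(a₁)^⊥ < W(a₂)^⊥` for `a₁ < a₂` (`W(a₂) < W(a₁)` and `U ↦ U^⊥` is strictly antitone). [cite: Bump1997, Thm. 2.5.3 (ii)] [cite: BorelWallach2000, 0 §2.5, I §2.2] -/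
theorem ann_upperR_lt_ann_upperR {a₁ a₂ : ℤ} (h₁ : lc s lam a₁ = 0) (h₂ : lc s lam a₂ = 0) (hlt : a₁ < a₂) :
    GKDual.ann G11 (U11TranslPS.isGKModule_psMod s lam) (upperR h₁) < GKDual.ann G11 (U11TranslPS.isGKModule_psMod s lam) (upperR h₂) := by
  refine U11DualFunctor.ann_strictAnti _ (lt_of_le_of_ne ((upperR_le_upperR_iff h₂ h₁).mpr hlt.le) fun heq => ?_)
  have hle : upperR h₁ ≤ upperR h₂ := heq.symm.le
  rw [upperR_le_upperR_iff h₁ h₂] at hle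
  omega

/-- **The submodules of `P~` are exactly `0, W(a₁)^⊥, W(a₂)^⊥, P~`** (zeros `a₁, a₂` with `a₁ + a₂ = s + 1`; `U ↦ U^⊥` is onto, g32-#10, and the
submodules of `P` are `0, W(a₂), W(a₁), P`). [cite: Bump1997, Thm. 2.5.3 (ii)–(iii)] [cite: BorelWallach2000, 0 §2.5, I §2.2] -/
theorem submodule_dualModule_psMod_cases {a₁ a₂ : ℤ} (h₁ : lc s lam a₁ = 0) (h₂ : lc s lam a₂ = 0) (h₁₂ : a₁ + a₂ = s + 1)
    (W : Submodule (GKRing G11) (GKDual.dualModule G11 (U11TranslPS.isGKModule_psMod s lam))) :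
    W = ⊥ ∨ W = GKDual.ann G11 (U11TranslPS.isGKModule_psMod s lam) (upperR h₁) ∨
      W = GKDual.ann G11 (U11TranslPS.isGKModule_psMod s lam) (upperR h₂) ∨ W = ⊤ := by
  obtain ⟨U, rfl⟩ := U11DualFunctor.ann_surjective _ isAdmissibleGK_psMod W
  rcases submodule_cases h₁ h₂ h₁₂ U with rfl | rfl | rfl | rfl
  · exact Or.inr (Or.inr (Or.inr (GKDual.ann_bot G11 _)))
  · exact Or.inr (Or.inr (Or.inl rfl))
  · exact Or.inr (Or.inl rfl)
  · exact Or.inl (GKDual.ann_top G11 _)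

end U11PS

end Literature.RepresentationTheory.BorelWallach2000
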